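import Literature.Analysis.FunctionSpaces.LatticeSobolevRellich
import Literature.Analysis.FunctionSpaces.TorusSpectralWeakDerivative
import Literature.Analysis.FunctionSpaces.TorusTrigPoly
import Literature.Analysis.FunctionSpaces.TorusSobolevSpace
import HarnessLib

/-!
# Rellich's lemma `H¹ ⊂⊂ L²` for real vector fields on the flat torus, in `L²` / energy-space form

Analysis/FunctionSpaces support file (everything proved; no definitions, no named facts). It transports
the lattice Rellich lemma `Lattice.rellich` (Warner 1983, Lemma 6.23: bounded in `H_t` ⇒ a subsequence
Cauchy in `H_s`, `s < t`) to real `L²` vector fields `v : T^d → ℝ^d` measured by the `L²` norm and the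
spectral squared gradient norm `Torus.eGradNormSq v = 4π² ∑ₖ |k|² ‖v̂(k)‖²`:

* `Torus.eNormSq_one_mFourierCoeff_complexify_le` — `‖𝓕(complexify ∘ v)‖²_{H_1} ≤ ‖v‖²_{L²} + (4π²)⁻¹ ‖∇v‖₂²`
  (indeed an identity) for `v ∈ L²(T^d; ℝ^d)`;
* `Torus.eNormSq_zero_mFourierCoeff_complexify_sub` — `‖𝓕(complexify ∘ v) − 𝓕(complexify ∘ w)‖²_{H_0} = ‖v − w‖²_{L²}`
  (Parseval, `Torus.eSobolevNorm_zero_complexify`, and linearity of the coefficients);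
* `Torus.exists_strictMono_cauchySeq_of_eGradNormSq_le` — **Rellich, sequence form**: a sequence in
  `L²(T^d; ℝ^d)` bounded in norm and in `eGradNormSq` has an `L²`-Cauchy subsequence;
* `Torus.isCompact_of_isClosed_of_eGradNormSq_le` — **set form**: a closed subset of `L²(T^d; ℝ^d)` on which
  the norm and `eGradNormSq` are bounded is compact;
* `Torus.isCompact_energySpace_of_isClosed_of_eGradNormSq_le` — the same inside the energy space
  `H = Torus.energySpace d` (closed in `L²`, hence complete): **bounded-enstrophy closed subsets of `H` are
  compact** (Constantin–Foias 1988, Ch. 4: the injection `V ⊂ H` is compact; Temam 1977, Ch. I Thm 1.1 /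
  (2.19); Robinson–Rodrigo–Sadowski 2016, Thm 1.19).

This is the compactness behind the phase-space enlargement and the compactness of the derivative of the
strong solution map (`H → V` bounded ⇒ compact in `H`) in the smooth-model construction for NS phases.

## Mathlib / tree search

Tree (reused): `Lattice.rellich`, `Lattice.eNormSq`, `Lattice.eNorm_pow_two` (`LatticeSobolev(Rellich)`),
`Torus.eSobolevNorm_eq_eNorm`, `Torus.eSobolevNorm_zero_complexify`, `Torus.integrable_complexify_comp`,
`Torus.mFourierCoeff_congr_ae` (`TorusVectorParseval`), `Torus.eGradNormSq_eq_tsum` (`TorusSpectralWeakDerivative`),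
`Torus.mFourierCoeff_sub` (`TorusTrigPoly`), `Torus.sobolevWeight_one_sq`, `Torus.sobolevWeight_zero`,
`Torus.isClosed_energySpace` (`TorusSobolevSpace`); Mathlib `Metric.cauchySeq_iff`, `cauchySeq_tendsto_of_complete`,
`IsSeqCompact.isCompact`, `tendsto_subtype_rng`, `Lp.enorm_def`, `Lp.coeFn_sub`. Searched `rellich` on the torus
side: only the lattice form (`Lattice.rellich`) and its consumers in `SteadyNSLatticePersistence`,
`TimePeriodicNSLatticeCompact` (coefficient families) and `Geometry/Kaehler/TorusDolbeaultCompactness` (forms);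
no `L²(T^d; ℝ^d)` / `energySpace` statement.

## References

* F. W. Warner, *Foundations of Differentiable Manifolds and Lie Groups*, GTM 94 (1983), Lemma 6.23.
  [WarnerGTM94]
* P. Constantin, C. Foias, *Navier–Stokes Equations*, Univ. Chicago Press 1988, Ch. 4 (the spaces `H`, `V`;
  compactness of `V ⊂ H`). [ConstantinFoiasNSE1988]
* J. C. Robinson, J. L. Rodrigo, W. Sadowski, *The Three-Dimensional Navier–Stokes Equations*, CUP 2016,
  Thm 1.19 (Rellich–Kondrachov on the torus). [RobinsonRodrigoSadowskiCUP2016]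
-/

noncomputable section

open _root_.MeasureTheory Set Filter Function Topology UnitAddTorus
open scoped ENNReal NNReal

namespace Literature.Analysis.FunctionSpaces

namespace Torus

variable {d : Type*} [Fintype d]

/-! ### The `H_1` and `H_0` lattice norms of the coefficients of a real `L²` field -/

/-- **`‖𝓕(complexify ∘ v)‖²_{H_0} = ‖v‖²`** for `v ∈ L²(T^d; ℝ^d)` (Parseval in the form
`Torus.eSobolevNorm_zero_complexify`). [folklore] -/
theorem eNormSq_zero_mFourierCoeff_complexify (v : (Lp (EuclideanSpace ℝ d) 2 (volume : Measure (UnitAddTorus d)))) :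
    Lattice.eNormSq 0 (mFourierCoeff (EuclideanSpace.complexify ∘ (v : UnitAddTorus d → EuclideanSpace ℝ d))) =
      ‖v‖ₑ ^ 2 := by
  rw [← Lattice.eNorm_pow_two, ← eSobolevNorm_eq_eNorm, eSobolevNorm_zero_complexify (Lp.memLp v),
    ← Lp.enorm_def]

/-- **`‖𝓕(complexify ∘ v)‖²_{H_1} ≤ ‖v‖² + (4π²)⁻¹ ‖∇v‖₂²`** for `v ∈ L²(T^d; ℝ^d)` (`⟨k⟩² = 1 + |k|²`, Parseval
for the first part and `Torus.eGradNormSq v = 4π² ∑ₖ |k|² ‖v̂(k)‖²` for the second; it is an identity, stated as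
the inequality that is consumed). [folklore] -/
theorem eNormSq_one_mFourierCoeff_complexify_le (v : (Lp (EuclideanSpace ℝ d) 2 (volume : Measure (UnitAddTorus d)))) :
    Lattice.eNormSq 1 (mFourierCoeff (EuclideanSpace.complexify ∘ (v : UnitAddTorus d → EuclideanSpace ℝ d))) ≤
      ‖v‖ₑ ^ 2 + (ENNReal.ofReal (4 * Real.pi ^ 2))⁻¹ *
        eGradNormSq (v : UnitAddTorus d → EuclideanSpace ℝ d) := by
  set c : (d → ℤ) → EuclideanSpace ℂ d :=
    mFourierCoeff (EuclideanSpace.complexify ∘ (v : UnitAddTorus d → EuclideanSpace ℝ d)) with hc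
  have hsplit : Lattice.eNormSq 1 c = Lattice.eNormSq 0 c + ∑' k, ENNReal.ofReal (freqNormSq k) * ‖c k‖ₑ ^ 2 := by
    rw [Lattice.eNormSq, Lattice.eNormSq, ← ENNReal.tsum_add]
    refine tsum_congr fun k => ?_
    rw [sobolevWeight_one_sq, sobolevWeight_zero, one_pow, ENNReal.ofReal_one, one_mul,
      ENNReal.ofReal_add zero_le_one (freqNormSq_nonneg k), ENNReal.ofReal_one, add_mul, one_mul]
  have h4π : ENNReal.ofReal (4 * Real.pi ^ 2) ≠ 0 := (ENNReal.ofReal_pos.2 (by positivity)).ne'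
  have hhom : ∑' k, ENNReal.ofReal (freqNormSq k) * ‖c k‖ₑ ^ 2 =
      (ENNReal.ofReal (4 * Real.pi ^ 2))⁻¹ * eGradNormSq (v : UnitAddTorus d → EuclideanSpace ℝ d) := by
    rw [eGradNormSq_eq_tsum, ← mul_assoc, ENNReal.inv_mul_cancel h4π ENNReal.ofReal_ne_top, one_mul]
  rw [hsplit, eNormSq_zero_mFourierCoeff_complexify, hhom]

/-- **`‖𝓕(complexify ∘ v) − 𝓕(complexify ∘ w)‖²_{H_0} = ‖v − w‖²`** for `v, w ∈ L²(T^d; ℝ^d)`: the coefficients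
are linear (`Torus.mFourierCoeff_sub`, through the a.e. identity `⇑(v − w) = ⇑v − ⇑w` and
`Torus.mFourierCoeff_congr_ae`) and Parseval. [folklore] -/
theorem eNormSq_zero_mFourierCoeff_complexify_sub (v w : (Lp (EuclideanSpace ℝ d) 2 (volume : Measure (UnitAddTorus d)))) :
    Lattice.eNormSq 0 (mFourierCoeff (EuclideanSpace.complexify ∘ (v : UnitAddTorus d → EuclideanSpace ℝ d)) -
        mFourierCoeff (EuclideanSpace.complexify ∘ (w : UnitAddTorus d → EuclideanSpace ℝ d))) =
      ‖v - w‖ₑ ^ 2 := by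
  have hiv : Integrable (EuclideanSpace.complexify ∘ (v : UnitAddTorus d → EuclideanSpace ℝ d)) volume :=
    integrable_complexify_comp ((Lp.memLp v).integrable one_le_two)
  have hiw : Integrable (EuclideanSpace.complexify ∘ (w : UnitAddTorus d → EuclideanSpace ℝ d)) volume :=
    integrable_complexify_comp ((Lp.memLp w).integrable one_le_two)
  have hfun : (EuclideanSpace.complexify ∘ (v : UnitAddTorus d → EuclideanSpace ℝ d)) -
      (EuclideanSpace.complexify ∘ (w : UnitAddTorus d → EuclideanSpace ℝ d)) =
      EuclideanSpace.complexify ∘ ((v : UnitAddTorus d → EuclideanSpace ℝ d) -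
        (w : UnitAddTorus d → EuclideanSpace ℝ d)) := by
    funext x
    simp only [Pi.sub_apply, Function.comp_apply, map_sub]
  have hae : (EuclideanSpace.complexify ∘
      ((v - w : (Lp (EuclideanSpace ℝ d) 2 (volume : Measure (UnitAddTorus d)))) : UnitAddTorus d → EuclideanSpace ℝ d)) =ᵐ[volume]
      EuclideanSpace.complexify ∘ ((v : UnitAddTorus d → EuclideanSpace ℝ d) -
        (w : UnitAddTorus d → EuclideanSpace ℝ d)) :=
    (Lp.coeFn_sub v w).fun_comp EuclideanSpace.complexify
  have hcoef : mFourierCoeff (EuclideanSpace.complexify ∘ (v : UnitAddTorus d → EuclideanSpace ℝ d)) -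
      mFourierCoeff (EuclideanSpace.complexify ∘ (w : UnitAddTorus d → EuclideanSpace ℝ d)) =
      mFourierCoeff (EuclideanSpace.complexify ∘
        ((v - w : (Lp (EuclideanSpace ℝ d) 2 (volume : Measure (UnitAddTorus d)))) : UnitAddTorus d → EuclideanSpace ℝ d)) := by
    funext k
    rw [Pi.sub_apply, ← mFourierCoeff_sub hiv hiw k, hfun, mFourierCoeff_congr_ae hae k]
  rw [hcoef, eNormSq_zero_mFourierCoeff_complexify]

/-! ### Rellich's lemma for real `L²` vector fields -/

/-- **Rellich's lemma on `T^d`, sequence form** (Warner 1983, Lemma 6.23, transported from the lattice by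
Parseval): a sequence `(vₙ)` in `L²(T^d; ℝ^d)` with `‖vₙ‖ ≤ R₀` and `‖∇vₙ‖₂² = eGradNormSq vₙ ≤ R₁ < ∞` has a
subsequence which is Cauchy in `L²` — the natural injection `H¹ → L²` is compact. Proof: the coefficient
families `𝓕(complexify ∘ vₙ)` are bounded in the lattice norm `H_1` (`eNormSq_one_mFourierCoeff_complexify_le`),
`Lattice.rellich` gives a subsequence Cauchy in `H_0`, and `H_0`-distances of coefficients are `L²`-distances of
the fields (`eNormSq_zero_mFourierCoeff_complexify_sub`). [cite: WarnerGTM94, Lemma 6.23] -/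
theorem exists_strictMono_cauchySeq_of_eGradNormSq_le
    {v : ℕ → (Lp (EuclideanSpace ℝ d) 2 (volume : Measure (UnitAddTorus d)))} {R₀ : ℝ} {R₁ : ℝ≥0∞}
    (hR₁ : R₁ ≠ ∞) (h0 : ∀ n, ‖v n‖ ≤ R₀)
    (h1 : ∀ n, eGradNormSq (v n : UnitAddTorus d → EuclideanSpace ℝ d) ≤ R₁) :
    ∃ φ : ℕ → ℕ, StrictMono φ ∧ CauchySeq (v ∘ φ) := by
  set c : ℕ → (d → ℤ) → EuclideanSpace ℂ d := fun n =>
    mFourierCoeff (EuclideanSpace.complexify ∘ (v n : UnitAddTorus d → EuclideanSpace ℝ d)) with hc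
  have h4π : ENNReal.ofReal (4 * Real.pi ^ 2) ≠ 0 := (ENNReal.ofReal_pos.2 (by positivity)).ne'
  set R : ℝ≥0∞ := ENNReal.ofReal R₀ ^ 2 + (ENNReal.ofReal (4 * Real.pi ^ 2))⁻¹ * R₁ with hR
  have hRtop : R ≠ ∞ := ENNReal.add_ne_top.2
    ⟨ENNReal.pow_ne_top ENNReal.ofReal_ne_top, ENNReal.mul_ne_top (ENNReal.inv_ne_top.2 h4π) hR₁⟩
  have hbound : ∀ n, Lattice.eNormSq 1 (c n) ≤ R := by
    intro n
    have hn : ‖v n‖ₑ ≤ ENNReal.ofReal R₀ := by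
      rw [← ofReal_norm]
      exact ENNReal.ofReal_le_ofReal (h0 n)
    calc Lattice.eNormSq 1 (c n)
        ≤ ‖v n‖ₑ ^ 2 + (ENNReal.ofReal (4 * Real.pi ^ 2))⁻¹ *
            eGradNormSq (v n : UnitAddTorus d → EuclideanSpace ℝ d) :=
          eNormSq_one_mFourierCoeff_complexify_le (v n)
      _ ≤ ENNReal.ofReal R₀ ^ 2 + (ENNReal.ofReal (4 * Real.pi ^ 2))⁻¹ * R₁ := by
          gcongr
          exact h1 n
  obtain ⟨φ, hφ, hC⟩ := Lattice.rellich (V := EuclideanSpace ℂ d) (s := (0 : ℝ)) (t := 1) zero_lt_one hRtop hbound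
  refine ⟨φ, hφ, Metric.cauchySeq_iff.2 fun ε hε => ?_⟩
  obtain ⟨N, hN⟩ := hC (ENNReal.ofReal ((ε / 2) ^ 2)) (ENNReal.ofReal_pos.2 (by positivity))
  refine ⟨N, fun m hm n hn => ?_⟩
  have h := hN m n hm hn
  have hcm : c (φ m) - c (φ n) =
      mFourierCoeff (EuclideanSpace.complexify ∘ (v (φ m) : UnitAddTorus d → EuclideanSpace ℝ d)) -
        mFourierCoeff (EuclideanSpace.complexify ∘ (v (φ n) : UnitAddTorus d → EuclideanSpace ℝ d)) := rfl
  rw [hcm, eNormSq_zero_mFourierCoeff_complexify_sub, ← ofReal_norm, ← ENNReal.ofReal_pow (norm_nonneg _),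
    ENNReal.ofReal_le_ofReal_iff (by positivity)] at h
  have h' : ‖v (φ m) - v (φ n)‖ ≤ ε / 2 := by
    have h2 := Real.sqrt_le_sqrt h
    rwa [Real.sqrt_sq (norm_nonneg _), Real.sqrt_sq (by positivity)] at h2
  show dist (v (φ m)) (v (φ n)) < ε
  rw [dist_eq_norm]
  linarith

/-- **Rellich's lemma on `T^d`, set form**: a closed subset of `L²(T^d; ℝ^d)` on which the norm and the spectral
squared gradient norm `eGradNormSq` are bounded is compact (sequential compactness from
`exists_strictMono_cauchySeq_of_eGradNormSq_le` and the completeness of `L²`; `IsSeqCompact.isCompact`).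
[cite: WarnerGTM94, Lemma 6.23] -/
theorem isCompact_of_isClosed_of_eGradNormSq_le
    {S : Set (Lp (EuclideanSpace ℝ d) 2 (volume : Measure (UnitAddTorus d)))} (hS : IsClosed S) {R₀ : ℝ} {R₁ : ℝ≥0∞}
    (hR₁ : R₁ ≠ ∞) (h0 : ∀ v ∈ S, ‖v‖ ≤ R₀)
    (h1 : ∀ v ∈ S, eGradNormSq ((v : (Lp (EuclideanSpace ℝ d) 2 (volume : Measure (UnitAddTorus d)))) :
      UnitAddTorus d → EuclideanSpace ℝ d) ≤ R₁) : IsCompact S := by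
  refine IsSeqCompact.isCompact fun w hw => ?_
  obtain ⟨φ, hφ, hCauchy⟩ := exists_strictMono_cauchySeq_of_eGradNormSq_le hR₁ (fun n => h0 _ (hw n))
    (fun n => h1 _ (hw n))
  obtain ⟨a, ha⟩ := cauchySeq_tendsto_of_complete hCauchy
  exact ⟨a, hS.mem_of_tendsto ha (Eventually.of_forall fun n => hw (φ n)), φ, hφ, ha⟩

/-- **Bounded-enstrophy closed subsets of the energy space `H` are compact** (Rellich inside
`H = Torus.energySpace d`, which is closed in `L²(T^d; ℝ^d)`; Constantin–Foias 1988, Ch. 4: the injection of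
`V` into `H` is compact): if `S ⊆ H` is closed and `‖v‖ ≤ R₀`, `eGradNormSq v ≤ R₁ < ∞` on `S`, then `S` is
compact. [cite: ConstantinFoiasNSE1988, Ch. 4 (compactness of V ⊂ H)] -/
theorem isCompact_energySpace_of_isClosed_of_eGradNormSq_le [DecidableEq d] {S : Set ↥(energySpace d)} (hS : IsClosed S)
    {R₀ : ℝ} {R₁ : ℝ≥0∞} (hR₁ : R₁ ≠ ∞) (h0 : ∀ v ∈ S, ‖v‖ ≤ R₀)
    (h1 : ∀ v ∈ S, eGradNormSq (((v : ↥(energySpace d)) : (Lp (EuclideanSpace ℝ d) 2 (volume : Measure (UnitAddTorus d)))) : UnitAddTorus d → EuclideanSpace ℝ d) ≤ R₁) :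
    IsCompact S := by
  refine IsSeqCompact.isCompact fun w hw => ?_
  obtain ⟨φ, hφ, hCauchy⟩ := exists_strictMono_cauchySeq_of_eGradNormSq_le (v := fun n => ((w n : ↥(energySpace d)) : (Lp (EuclideanSpace ℝ d) 2 (volume : Measure (UnitAddTorus d)))))
    hR₁ (fun n => h0 _ (hw n)) (fun n => h1 _ (hw n))
  obtain ⟨a, ha⟩ := cauchySeq_tendsto_of_complete hCauchy
  have haE : a ∈ energySpace d :=
    isClosed_energySpace.mem_of_tendsto ha (Eventually.of_forall fun n => (w (φ n)).2)
  have ht : Tendsto (w ∘ φ) atTop (𝓝 ⟨a, haE⟩) := tendsto_subtype_rng.2 ha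
  exact ⟨⟨a, haE⟩, hS.mem_of_tendsto ht (Eventually.of_forall fun n => hw (φ n)), φ, hφ, ht⟩

end Torus

end Literature.Analysis.FunctionSpaces

end
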